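import Mathlib.MeasureTheory.Constructions.Cylinders
import Mathlib.MeasureTheory.Integral.Bochner.SumMeasure
import Mathlib.MeasureTheory.Measure.Real
import Mathlib.Logic.Function.DependsOn
import Literature.Probability.LatticeModels.RandomCurrentsProofs
import HarnessLib

/-!
# Random currents with prescribed sources: the finite-volume law `𝐏^A_{G,β}` and the
# infinite-volume sourced current on `ℤ^d`

Topic `Probability/LatticeModels`, namespace `Literature.Probability.LatticeModels`. Definition
request `defn-sourcedCurrentLaw` (route `MeanCurrentCircleLaw` of `CriticalPhenomena`, and the
current-sector idea cards listed there).

* `currentLaw G β A` — for a finite graph `G`, the **random current with source set `A`**,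
  the probability measure on `Current G` with `𝐏^A_{G,β}[n] = w_β(n) 𝟙[∂n = A] / ∑_{∂m = A} w_β(m)`
  (Duminil-Copin, *Random currents expansion of the Ising model*, Def. 3.2 "Distribution on
  currents"; Aizenman–Duminil-Copin 2021, §3.2, definition of `𝐏^A_{Λ,β}`), written — as the
  tree's `doubleCurrentMeasure G β A B = 𝐏^A ⊗ 𝐏^B` (`RandomCurrents.lean`) — as an explicit
  normalised sum of Dirac masses, with the single-current probabilities `currentProb G β A n`;
  `integral_currentLaw_eq_tsum_div` identifies its expectations with the quotients of current sums
  `(∑_n 𝟙[∂n = A] w_β(n) f(n)) / ∑_{∂n = A} w_β(n)` in which route items are written.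
* `Torus.liftCurrent d L`, `torusCurrentLaw d L β A` — the sourced current of the discrete torus
  `(ℤ/Lℤ)^d` (`torusGraph d L`, sources `A.image (Torus.proj L)`), read as an `L`-periodic element
  of `Ω_{ℤ^d} = ℕ^{𝒫₂(ℤ^d)}` (ADS15 §2.2: the state space `{0,1,2,…}^{𝒫₂(ℤ^d)}` of the
  infinite-volume currents), here `Sym2 (Site d) → ℕ` with non-lattice pairs carrying `0`.
* `IsLocalLimit P μ` — `μ` is a probability measure and `P N [E] → μ[E]` for every event `E`
  depending on finitely many coordinates (ADS15 Thm. 2.3 (R1): "for any event `𝒜` depending on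
  finitely many edges"); such a limit is unique (`IsLocalLimit.unique`, cylinders form a π-system
  generating the product σ-algebra).
* `IsSourcedCurrentLimit d β A μ`, `sourcedCurrentLaw_limit_exists d β A` and
  **`sourcedCurrentLaw d β A : Measure (Sym2 (Site d) → ℕ)`** — the infinite-volume random current
  on `ℤ^d` with finite source set `A` at inverse temperature `β`: the local weak limit of the torus
  laws `torusCurrentLaw d (N+1) β A`, `N → ∞`, when it exists (junk value `0` otherwise).

## What the sources print, and what is a design choice

Infinite-volume random currents *with sources* are introduced in Aizenman–Duminil-Copin–Tassion–
Warzel 2019, §2.3 ("the probability measures `𝐏^A_{G,β}` … can be defined for infinite graphs … by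
taking the limit of measures on finite subgraphs. For ferromagnetic interactions, the corresponding
measures converge in the natural (weak) sense. We call any such limit an infinite-volume
random-current measure … Proofs … can be found in [ADS15]. The general case of `A` arbitrary
follows from the same proofs") and used in Aizenman–Duminil-Copin 2021, §3.2 ("the weak limits of
the random current measures `𝐏^A_{Λ_n,β}` … in the limit `Λ_n ↗ ℤ^d`"); ADS15 Thm. 2.3 proves
R1 for the sourceless currents of the boxes `Λ_L` (in tree, on the trace: `CurrentsTraceLaw.lean`,
`DoubleCurrentsInfinite.lean`, whose `adsDoubleCurrentLawInf`/`IsAdsLimit.unique` this file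
copies). **The finite volumes used here are the tori `(ℤ/(N+1)ℤ)^d`**, because that is the
approximation in which the requesting route (`MeanCurrentCircleLaw`: items `MeanCurrentExists`,
`CircleLaw`, `KirchhoffTorus`) writes its sourced currents; the printed sources exhaust `ℤ^d` by
boxes / finite subgraphs. No existence statement is asserted: `sourcedCurrentLaw_limit_exists d β A`
is a *predicate* (for `A = {x, y}` at `β = β_c(3)` its first-moment shadow is that route's crux
`MeanCurrentExists`), and every statement about `sourcedCurrentLaw` carries it as a hypothesis.
`IsLocalLimit` is stated for an arbitrary sequence of finite-volume laws, so that the box /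
free-boundary variant is the same predicate applied to another sequence.

Junk values (documented on the declarations): `currentLaw G β A = 0` if `∑_{∂n = A} w_β(n) = 0`
(no current with sources `A`, e.g. `|A|` odd, or `β = 0 ≠ |A|`); for `β < 0` the truncation
`ENNReal.ofReal` makes it meaningless, and all probabilistic statements carry `0 ≤ β`;
`sourcedCurrentLaw d β A = 0` if the local limit does not exist.

## Mathlib status

No random currents in Mathlib. Anchors: `Measure.sum`, `Measure.dirac`, `Measure.map`,
`MeasureTheory.integral_sum_dirac`, `DependsOn`, `MeasureTheory.cylinder`,
`MeasureTheory.measurableCylinders`, `generateFrom_measurableCylinders`,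
`isPiSystem_measurableCylinders`, `ext_of_generate_finite`, `ZMod.intCast_eq_intCast_iff_dvd_sub`.

## References

* H. Duminil-Copin, *Random currents expansion of the Ising model*, in: European Congress of
  Mathematics (Berlin 2016), EMS 2018, 869–889, arXiv:1607.06933 — Def. 3.2 (numbering of the
  arXiv source held in the store; its Lemma 3.1 is the switching lemma).
* M. Aizenman, H. Duminil-Copin, *Marginal triviality of the scaling limits of critical 4D Ising
  and `φ⁴₄` models*, Ann. of Math. 194 (2021) — §3.2 (arXiv:1912.07973 numbering), `𝐏^A_{Λ,β}`.
* M. Aizenman, H. Duminil-Copin, V. Tassion, S. Warzel, *Emergent planarity in two-dimensional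
  Ising models with finite-range interactions*, Invent. Math. 216 (2019) — §2.3.
* M. Aizenman, H. Duminil-Copin, V. Sidoravicius, *Random currents and continuity of Ising model's
  spontaneous magnetization*, Comm. Math. Phys. 334 (2015) — §2.2 and Thm. 2.3 ("ADS15").
-/

noncomputable section

open MeasureTheory Filter Topology Finset
open scoped symmDiff

namespace Literature.Probability.LatticeModels

/-! ### The finite-volume sourced current `𝐏^A_{G,β}` -/

section Finite

variable {V : Type*} [Fintype V] [DecidableEq V] (G : SimpleGraph V) [DecidableRel G.Adj]

/-- The probability of the current `n` under the random current with sources `A`: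
`𝐏^A_{G,β}[n] = 𝟙[∂n = A] w_β(n) / ∑_{∂m = A} w_β(m)` (Duminil-Copin, Def. 3.2; the denominator is
the tree's `currentSum G β A`). Junk: `0` for every `n` if `currentSum G β A = 0`. [cite: DuminilCopin2016, Def. 3.2] -/
def currentProb (β : ℝ) (A : Finset V) (n : Current G) : ℝ :=
  (if n.sources = A then n.weight β else 0) / currentSum G β A

/-- **The random current with source set `A`** on the finite graph `G` at inverse temperature `β`:
the measure `𝐏^A_{G,β}` on currents with `𝐏^A_{G,β}[n] = w_β(n) 𝟙[∂n = A] / ∑_{∂m = A} w_β(m)`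
(Duminil-Copin, Def. 3.2 "Distribution on currents"; Aizenman–Duminil-Copin 2021, §3.2,
`𝐏^A_{Λ,β}(n) := 2^{|Λ|} w(n) 𝕀[∂n = A] / (⟨σ_A⟩_{Λ,β} Z(Λ,β))`, the same quotient by the
random-current representation (2.2) of `RandomCurrents.lean`). An explicit normalised sum of Dirac
masses, as the tree's `doubleCurrentMeasure` (`= 𝐏^A ⊗ 𝐏^B`). **Junk**: the zero measure if
`currentSum G β A = 0`; meaningless for `β < 0` (negative weights are truncated by
`ENNReal.ofReal`), whence the hypothesis `0 ≤ β` in every probabilistic statement. [cite: DuminilCopin2016, Def. 3.2] -/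
def currentLaw (β : ℝ) (A : Finset V) : Measure (Current G) :=
  Measure.sum fun n : Current G => ENNReal.ofReal (currentProb G β A n) • Measure.dirac n

variable {G}

/-- The single-current probabilities are nonnegative for `β ≥ 0`. [cite: DuminilCopin2016, Def. 3.2] -/
theorem currentProb_nonneg {β : ℝ} (hβ : 0 ≤ β) (A : Finset V) (n : Current G) :
    0 ≤ currentProb G β A n := by
  unfold currentProb
  refine div_nonneg ?_ (currentSum_nonneg G hβ A)
  split_ifs
  · exact Current.weight_nonneg hβ n
  · exact le_rfl

/-- `𝐏^A_{G,β}` is supported on `{n | ∂n = A}`. [cite: DuminilCopin2016, Def. 3.2] -/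
theorem currentProb_of_sources_ne {β : ℝ} {A : Finset V} {n : Current G} (h : n.sources ≠ A) :
    currentProb G β A n = 0 := by
  simp [currentProb, h]

variable (G)

/-- The single-current probabilities are summable (the weights are, `RandomCurrentsProofs.lean`). [cite: DuminilCopin2016, Def. 3.2] -/
theorem summable_currentProb (β : ℝ) (A : Finset V) : Summable (currentProb G β A) :=
  (summable_currentWeight_indicator_holds G β A).div_const _

/-- The single-current probabilities sum to `1` as soon as a current with sources `A` exists
(`currentSum G β A ≠ 0`). [cite: DuminilCopin2016, Def. 3.2] -/
theorem hasSum_currentProb (β : ℝ) {A : Finset V} (hA : currentSum G β A ≠ 0) :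
    HasSum (currentProb G β A) 1 := by
  have h := (summable_currentWeight_indicator_holds G β A).hasSum.div_const (currentSum G β A)
  have hZ : (∑' n : Current G, if n.sources = A then n.weight β else 0) = currentSum G β A := rfl
  rw [hZ, div_self hA] at h
  exact h

open Classical in
/-- The measure of a set of currents under `𝐏^A_{G,β}` (every set of the countable type of
currents is measurable). [cite: DuminilCopin2016, Def. 3.2] -/
theorem currentLaw_apply (β : ℝ) (A : Finset V) (s : Set (Current G)) :
    currentLaw G β A s = ∑' n, if n ∈ s then ENNReal.ofReal (currentProb G β A n) else 0 := by
  rw [currentLaw, Measure.sum_apply_of_countable]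
  refine tsum_congr fun n => ?_
  rw [Measure.smul_apply, Measure.dirac_apply, smul_eq_mul]
  by_cases hn : n ∈ s <;> simp [hn]

open Classical in
/-- The probability of a set of currents under `𝐏^A_{G,β}`, `β ≥ 0`, as a real series. [cite: DuminilCopin2016, Def. 3.2] -/
theorem currentLaw_real_apply {β : ℝ} (hβ : 0 ≤ β) (A : Finset V) (s : Set (Current G)) :
    (currentLaw G β A).real s = ∑' n, if n ∈ s then currentProb G β A n else 0 := by
  have hnn : ∀ n, 0 ≤ (if n ∈ s then currentProb G β A n else 0) := fun n => by
    split_ifs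
    · exact currentProb_nonneg hβ A n
    · exact le_rfl
  have hsum : Summable fun n => if n ∈ s then currentProb G β A n else 0 :=
    (summable_currentProb G β A).of_nonneg_of_le hnn fun n => by
      split_ifs
      · exact le_rfl
      · exact currentProb_nonneg hβ A n
  rw [measureReal_def, currentLaw_apply, ← ENNReal.toReal_ofReal (tsum_nonneg hnn),
    ENNReal.ofReal_tsum_of_nonneg hnn hsum]
  congr 1
  refine tsum_congr fun n => ?_
  split_ifs <;> simp

/-- **`𝐏^A_{G,β}` is a probability measure** for `β ≥ 0` as soon as a current with sources `A`
exists (Duminil-Copin, Def. 3.2: "`𝐏^A` is supported on `{n : ∂n = A}`"). [cite: DuminilCopin2016, Def. 3.2] -/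
theorem isProbabilityMeasure_currentLaw {β : ℝ} (hβ : 0 ≤ β) {A : Finset V}
    (hA : currentSum G β A ≠ 0) : IsProbabilityMeasure (currentLaw G β A) := by
  constructor
  rw [currentLaw_apply]
  simp only [Set.mem_univ, if_true]
  rw [← ENNReal.ofReal_tsum_of_nonneg (currentProb_nonneg hβ A) (summable_currentProb G β A),
    (hasSum_currentProb G β hA).tsum_eq, ENNReal.ofReal_one]

/-- The junk case: if no current has sources `A` (`currentSum G β A = 0`), `𝐏^A_{G,β}` is the
zero measure. [folklore] -/
theorem currentLaw_eq_zero_of_currentSum_eq_zero {β : ℝ} {A : Finset V}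
    (hA : currentSum G β A = 0) : currentLaw G β A = 0 := by
  rw [currentLaw]
  simp [currentProb, hA]

/-- **Expectations under `𝐏^A_{G,β}`** (`β ≥ 0`): `∫ f d𝐏^A_{G,β} = ∑_n 𝐏^A_{G,β}[n] f(n)` for
every real `f` on currents (both sides are `0` when the series diverges). [cite: DuminilCopin2016, Def. 3.2] -/
theorem integral_currentLaw {β : ℝ} (hβ : 0 ≤ β) (A : Finset V) (f : Current G → ℝ) :
    ∫ n, f n ∂(currentLaw G β A) = ∑' n, currentProb G β A n * f n := by
  rw [currentLaw, integral_sum_dirac fun n => ENNReal.ofReal_ne_top]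
  refine tsum_congr fun n => ?_
  rw [ENNReal.toReal_ofReal (currentProb_nonneg hβ A n), smul_eq_mul]

/-- **Expectations as quotients of current sums** (`β ≥ 0`):
`∫ f d𝐏^A_{G,β} = (∑_n 𝟙[∂n = A] w_β(n) f(n)) / ∑_{∂n = A} w_β(n)` — the form in which sourced
random-current expectations are written in the route files (e.g. the torus mean currents `J_N` of
`MeanCurrentCircleLaw`). [cite: DuminilCopin2016, Def. 3.2] -/
theorem integral_currentLaw_eq_tsum_div {β : ℝ} (hβ : 0 ≤ β) (A : Finset V) (f : Current G → ℝ) :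
    ∫ n, f n ∂(currentLaw G β A) =
      (∑' n : Current G, (if n.sources = A then n.weight β else 0) * f n) / currentSum G β A := by
  rw [integral_currentLaw G hβ A f, ← tsum_div_const]
  refine tsum_congr fun n => ?_
  rw [currentProb, div_mul_eq_mul_div]

end Finite

/-! ### The sourced current of the discrete torus, read on `Ω_{ℤ^d}` -/

section Torus

variable (d : ℕ)

/-- `Torus.proj` is additive (coordinatewise `Int.cast`); a private copy of `Torus.proj_add` of
`TwoPointLogConvex.lean`, which is not imported to keep this file's imports light. [folklore] -/
private theorem Torus.proj_add' (L : ℕ) (x y : Site d) :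
    Torus.proj L (x + y) = Torus.proj L x + Torus.proj L y := by
  funext i
  simp [Torus.proj, Int.cast_add]

/-- Two distinct sites whose coordinates differ by less than `L` have distinct projections to
the torus `(ℤ/Lℤ)^d`. [folklore] -/
theorem Torus.proj_ne_of_abs_sub_lt {L : ℕ} {x y : Site d} (hxy : x ≠ y)
    (hL : ∀ i, |y i - x i| < L) : Torus.proj L x ≠ Torus.proj L y := by
  intro h
  apply hxy
  funext i
  have hi : (x i : ZMod L) = (y i : ZMod L) := by
    simpa [Torus.proj] using congr_fun h i
  rw [ZMod.intCast_eq_intCast_iff_dvd_sub] at hi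
  have h0 : y i - x i = 0 := Int.eq_zero_of_abs_lt_dvd hi (hL i)
  omega

/-- Distinct sites of `ℤ^d` have distinct projections to `(ℤ/Lℤ)^d` for all large `L`. [folklore] -/
theorem Torus.eventually_proj_ne {x y : Site d} (hxy : x ≠ y) :
    ∀ᶠ L : ℕ in atTop, Torus.proj L x ≠ Torus.proj L y := by
  have hM : ∀ i, ∀ᶠ L : ℕ in atTop, |y i - x i| < L := fun i => by
    filter_upwards [eventually_gt_atTop (y i - x i).natAbs] with L hL
    rw [← Int.natCast_natAbs]
    exact_mod_cast hL
  filter_upwards [eventually_all.2 hM] with L hL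
  exact Torus.proj_ne_of_abs_sub_lt d hxy hL

/-- For distinct sites `x ≠ y` and all large `L`, the projected source set of the pair `{x, y}`
is the two-point source set `{x̄} ∆ {ȳ}` in which the route files write the sources of the torus
current from `x` to `y` (so `torusCurrentLaw d L β {x, y}` is eventually that law). [folklore] -/
theorem Torus.eventually_image_pair_eq_symmDiff {x y : Site d} (hxy : x ≠ y) :
    ∀ᶠ L : ℕ in atTop, ({x, y} : Finset (Site d)).image (Torus.proj L) =
      {Torus.proj L x} ∆ {Torus.proj L y} := by
  filter_upwards [Torus.eventually_proj_ne d hxy] with L hL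
  rw [Finset.image_insert, Finset.image_singleton, Current.symmDiff_singleton_eq_pair hL]

/-- For `L ≥ 2`, every nearest-neighbour bond of `ℤ^d` projects to an edge of the torus graph
`(ℤ/Lℤ)^d` (`x ∼ x + eᵢ ↦ x̄ ∼ x̄ + eᵢ`, and `x̄ ≠ x̄ + eᵢ` because `1 ≠ 0` in `ℤ/Lℤ`). [cite: FriedliVelenik2017, §3.1] -/
theorem Torus.map_proj_mem_edgeFinset {L : ℕ} [NeZero L] (hL : 2 ≤ L) {e : Sym2 (Site d)}
    (he : e ∈ (zdGraph d).edgeSet) : e.map (Torus.proj L) ∈ (torusGraph d L).edgeFinset := by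
  induction e using Sym2.ind with
  | _ x y =>
    rw [Sym2.map_mk, SimpleGraph.mem_edgeFinset, SimpleGraph.mem_edgeSet, torusGraph_adj_iff]
    rw [SimpleGraph.mem_edgeSet, zdGraph_adj_iff] at he
    haveI : Fact (1 < L) := ⟨hL⟩
    have key : ∀ (u : Site d) (i : Fin d),
        Torus.proj L (u + Pi.single i 1) = Torus.proj L u + Pi.single i 1 ∧
          Torus.proj L u ≠ Torus.proj L (u + Pi.single i 1) := by
      intro u i
      have hadd : Torus.proj L (u + Pi.single i 1) = Torus.proj L u + Pi.single i 1 := by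
        rw [Torus.proj_add']
        congr 1
        funext j
        rcases eq_or_ne j i with rfl | hj
        · simp [Torus.proj]
        · simp [Torus.proj, hj]
      refine ⟨hadd, fun h => ?_⟩
      have h' := congr_fun (h.trans hadd) i
      simp only [Pi.add_apply, Pi.single_eq_same, left_eq_add] at h'
      exact one_ne_zero h'
    obtain ⟨i, rfl | rfl⟩ := he
    · exact ⟨(key x i).2, Or.inl ⟨i, (key x i).1⟩⟩
    · exact ⟨(key y i).2.symm, Or.inr ⟨i, (key y i).1⟩⟩

/-- **The periodic lift of a torus current to `Ω_{ℤ^d} = ℕ^{𝒫₂(ℤ^d)}`** (ADS15 §2.2: the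
infinite-volume currents live on `{0,1,2,…}^{𝒫₂(ℤ^d)}`, here `Sym2 (Site d) → ℕ`): a
nearest-neighbour bond `e` of `ℤ^d` carries the current of its projection `ē` to the torus, every
other pair carries `0` (so the lift is an `L`-periodic lattice current). [cite: AizenmanDuminilCopinSidoraviciusCMP2015, §2.2] -/
def Torus.liftCurrent (L : ℕ) [NeZero L] (n : Current (torusGraph d L)) : Sym2 (Site d) → ℕ :=
  fun e => if h : e ∈ (zdGraph d).edgeSet ∧ e.map (Torus.proj L) ∈ (torusGraph d L).edgeFinset
    then n ⟨e.map (Torus.proj L), h.2⟩ else 0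

/-- Non-lattice pairs carry no current in the lift. [cite: AizenmanDuminilCopinSidoraviciusCMP2015, §2.2] -/
theorem Torus.liftCurrent_apply_of_not_mem {L : ℕ} [NeZero L] (n : Current (torusGraph d L))
    {e : Sym2 (Site d)} (he : e ∉ (zdGraph d).edgeSet) : Torus.liftCurrent d L n e = 0 := by
  simp [Torus.liftCurrent, he]

/-- On a lattice bond the lift reads the current of the projected torus edge (`L ≥ 2`). [cite: AizenmanDuminilCopinSidoraviciusCMP2015, §2.2] -/
theorem Torus.liftCurrent_apply_of_mem {L : ℕ} [NeZero L] (hL : 2 ≤ L)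
    (n : Current (torusGraph d L)) {e : Sym2 (Site d)} (he : e ∈ (zdGraph d).edgeSet) :
    Torus.liftCurrent d L n e = n ⟨e.map (Torus.proj L), Torus.map_proj_mem_edgeFinset d hL he⟩ := by
  simp [Torus.liftCurrent, he, Torus.map_proj_mem_edgeFinset d hL he]

/-- The lift of the zero current is the zero configuration. [folklore] -/
@[simp] theorem Torus.liftCurrent_zero (L : ℕ) [NeZero L] :
    Torus.liftCurrent d L (0 : Current (torusGraph d L)) = 0 := by
  funext e
  simp [Torus.liftCurrent]

/-- The lift is measurable (its domain is countable with measurable singletons). [folklore] -/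
theorem Torus.measurable_liftCurrent (L : ℕ) [NeZero L] :
    Measurable (Torus.liftCurrent d L) :=
  measurable_of_countable _

/-- **The sourced random current of the torus `(ℤ/Lℤ)^d`, read on `Ω_{ℤ^d}`**: the law
`𝐏^{Ā}_{𝕋_L,β}` (`currentLaw` of `torusGraph d L` with sources `Ā = A.image (Torus.proj L)`, the
projected source set; the law is `∝ 𝟙[∂n = Ā] w_β(n)`) pushed forward along the periodic lift
`Torus.liftCurrent`. These are the finite-volume laws whose `L → ∞` limit on local events is the
infinite-volume sourced current (ADTW19 §2.3 take finite subgraphs, ADS15 Thm. 2.3 the boxes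
`Λ_L`; the torus is the approximation used by route `MeanCurrentCircleLaw`). Junk as for
`currentLaw` (zero measure if no torus current has sources `Ā`, e.g. when two points of `A` have
the same projection and `|Ā|` is odd; `β < 0` meaningless). [cite: AizenmanEtAl2019, §2.3] -/
def torusCurrentLaw (L : ℕ) [NeZero L] (β : ℝ) (A : Finset (Site d)) :
    Measure (Sym2 (Site d) → ℕ) :=
  (currentLaw (torusGraph d L) β (A.image (Torus.proj L))).map (Torus.liftCurrent d L)

/-- The torus law of a measurable event is the `𝐏^{Ā}_{𝕋_L,β}`-probability of its preimage under
the lift. [cite: AizenmanEtAl2019, §2.3] -/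
theorem torusCurrentLaw_apply (L : ℕ) [NeZero L] (β : ℝ) (A : Finset (Site d))
    {E : Set (Sym2 (Site d) → ℕ)} (hE : MeasurableSet E) :
    torusCurrentLaw d L β A E =
      currentLaw (torusGraph d L) β (A.image (Torus.proj L)) (Torus.liftCurrent d L ⁻¹' E) := by
  rw [torusCurrentLaw, Measure.map_apply (Torus.measurable_liftCurrent d L) hE]

/-- The torus law is a probability measure for `β ≥ 0` whenever a torus current with the
projected sources exists. [cite: AizenmanEtAl2019, §2.3] -/
theorem isProbabilityMeasure_torusCurrentLaw (L : ℕ) [NeZero L] {β : ℝ} (hβ : 0 ≤ β)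
    {A : Finset (Site d)} (hA : currentSum (torusGraph d L) β (A.image (Torus.proj L)) ≠ 0) :
    IsProbabilityMeasure (torusCurrentLaw d L β A) := by
  haveI := isProbabilityMeasure_currentLaw (torusGraph d L) hβ hA
  exact Measure.isProbabilityMeasure_map (Torus.measurable_liftCurrent d L).aemeasurable

end Torus

/-! ### Local events and local weak limits on `ℕ^ι` -/

section LocalLimit

variable {ι : Type*}

/-- Membership in a cylinder `cylinder I S` depends only on the coordinates in `I`. [folklore] -/
theorem dependsOn_mem_cylinder (I : Finset ι) (S : Set (I → ℕ)) :
    DependsOn (· ∈ cylinder (α := fun _ : ι => ℕ) I S) (I : Set ι) := by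
  intro x y hxy
  have h : I.restrict x = I.restrict y := funext fun i => hxy i i.2
  simp only [mem_cylinder, h]

/-- An event depending on finitely many coordinates is the cylinder over its set of restrictions. [folklore] -/
theorem eq_cylinder_of_dependsOn {E : Set (ι → ℕ)} {I : Finset ι}
    (hE : DependsOn (· ∈ E) (I : Set ι)) :
    E = cylinder (α := fun _ : ι => ℕ) I (I.restrict '' E) := by
  ext x
  simp only [mem_cylinder, Set.mem_image]
  constructor
  · exact fun hx => ⟨x, hx, rfl⟩
  · rintro ⟨y, hy, hyx⟩
    have h : (y ∈ E) = (x ∈ E) := hE fun i hi => by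
      simpa using congr_fun hyx ⟨i, hi⟩
    exact h ▸ hy

/-- An event depending on finitely many coordinates of `ℕ^ι` is a measurable cylinder. [folklore] -/
theorem mem_measurableCylinders_of_dependsOn {E : Set (ι → ℕ)} {I : Finset ι}
    (hE : DependsOn (· ∈ E) (I : Set ι)) : E ∈ measurableCylinders fun _ : ι => ℕ := by
  rw [mem_measurableCylinders]
  exact ⟨I, I.restrict '' E, (Set.to_countable _).measurableSet, eq_cylinder_of_dependsOn hE⟩

/-- An event depending on finitely many coordinates of `ℕ^ι` is measurable. [folklore] -/
theorem measurableSet_of_dependsOn {E : Set (ι → ℕ)} {I : Finset ι}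
    (hE : DependsOn (· ∈ E) (I : Set ι)) : MeasurableSet E :=
  MeasurableSet.of_mem_measurableCylinders (mem_measurableCylinders_of_dependsOn hE)

/-- **`μ` is the local weak limit of the finite-volume laws `P N`**: a probability measure on
`ℕ^ι` such that `P N [E] → μ[E]` for every event `E` depending on finitely many coordinates — the
mode of convergence of ADS15 Thm. 2.3 (R1) ("for any event `𝒜` depending on finitely many edges,
`lim_L P̂_{Λ_L,β}[𝒜] = P̂_β[𝒜]`") and of ADTW19 §2.3 ("any such limit an infinite-volume
random-current measure"), for an arbitrary approximating sequence `P`. [cite: AizenmanDuminilCopinSidoraviciusCMP2015, Thm. 2.3 (R1)] -/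
structure IsLocalLimit (P : ℕ → Measure (ι → ℕ)) (μ : Measure (ι → ℕ)) : Prop where
  /-- The limit is a probability measure. -/
  isProbabilityMeasure : IsProbabilityMeasure μ
  /-- R1: convergence on events depending on finitely many coordinates. -/
  tendsto_of_dependsOn : ∀ (E : Set (ι → ℕ)) (I : Finset ι), DependsOn (· ∈ E) (I : Set ι) →
    Tendsto (fun N => (P N).real E) atTop (𝓝 (μ.real E))

/-- **Local weak limits are unique**: two probability measures to which `P N` converges on all
events depending on finitely many coordinates agree on the measurable cylinders, a π-system
generating the product σ-algebra (`generateFrom_measurableCylinders`). [folklore] -/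
theorem IsLocalLimit.unique {P : ℕ → Measure (ι → ℕ)} {μ ν : Measure (ι → ℕ)}
    (hμ : IsLocalLimit P μ) (hν : IsLocalLimit P ν) : μ = ν := by
  haveI := hμ.isProbabilityMeasure
  haveI := hν.isProbabilityMeasure
  refine ext_of_generate_finite (measurableCylinders fun _ : ι => ℕ)
    generateFrom_measurableCylinders.symm isPiSystem_measurableCylinders (fun E hE => ?_)
    (by rw [measure_univ, measure_univ])
  obtain ⟨I, S, -, rfl⟩ := (mem_measurableCylinders E).1 hE
  have h := tendsto_nhds_unique (hμ.tendsto_of_dependsOn _ I (dependsOn_mem_cylinder I S))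
    (hν.tendsto_of_dependsOn _ I (dependsOn_mem_cylinder I S))
  exact (measureReal_eq_measureReal_iff (measure_ne_top μ _) (measure_ne_top ν _)).1 h

end LocalLimit

/-! ### The infinite-volume sourced current on `ℤ^d` -/

section Infinite

variable (d : ℕ)

/-- `μ` **is the infinite-volume random current on `ℤ^d` with source set `A` at inverse
temperature `β`**: the local weak limit (`IsLocalLimit`: probability measure, convergence on every
event depending on finitely many bonds) of the sourced currents of the tori `(ℤ/(N+1)ℤ)^d`,
`torusCurrentLaw d (N+1) β A`, as `N → ∞` (ADTW19 §2.3; ADS15 Thm. 2.3 (R1) for the mode of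
convergence; torus approximation = design choice of route `MeanCurrentCircleLaw`, see the module
docstring). Unique when it exists (`IsLocalLimit.unique`). [cite: AizenmanEtAl2019, §2.3] -/
def IsSourcedCurrentLimit (β : ℝ) (A : Finset (Site d)) (μ : Measure (Sym2 (Site d) → ℕ)) : Prop :=
  IsLocalLimit (fun N : ℕ => torusCurrentLaw d (N + 1) β A) μ

/-- **The infinite-volume sourced current exists at `(β, A)`**: some probability measure is the
local weak limit of the torus laws `torusCurrentLaw d (N+1) β A`. A *predicate*, not an asserted
fact: ADTW19 §2.3 state convergence along finite subgraphs for ferromagnetic interactions ("the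
general case of `A` arbitrary follows from the same proofs" as ADS15 Thm. 2.3); along tori it is,
for `A = {x, y}` and `β = β_c(3)`, the law-level form of the crux `MeanCurrentExists` of route
`MeanCurrentCircleLaw`. [cite: AizenmanEtAl2019, §2.3] -/
def sourcedCurrentLaw_limit_exists (β : ℝ) (A : Finset (Site d)) : Prop :=
  ∃ μ, IsSourcedCurrentLimit d β A μ

open Classical in
/-- **The infinite-volume random current on `ℤ^d` with finite source set `A` at inverse
temperature `β`**, `𝐏^A_{ℤ^d,β}`: the probability measure on `Ω_{ℤ^d} = ℕ^{𝒫₂(ℤ^d)}`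
(`Sym2 (Site d) → ℕ`) that is the local weak limit of the torus laws `∝ 𝟙[∂n = Ā] w_β(n)`
(`torusCurrentLaw d (N+1) β A`, `N → ∞`) — "any such limit an infinite-volume random-current
measure" (ADTW19 §2.3), here unique (`IsLocalLimit.unique`); **junk value** `0` when the limit does
not exist (`sourcedCurrentLaw_limit_exists d β A` fails). [cite: AizenmanEtAl2019, §2.3] -/
def sourcedCurrentLaw (β : ℝ) (A : Finset (Site d)) : Measure (Sym2 (Site d) → ℕ) :=
  if h : sourcedCurrentLaw_limit_exists d β A then h.choose else 0

variable {d}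

/-- If the limit exists, `sourcedCurrentLaw d β A` is one. [cite: AizenmanEtAl2019, §2.3] -/
theorem isSourcedCurrentLimit_sourcedCurrentLaw {β : ℝ} {A : Finset (Site d)}
    (h : sourcedCurrentLaw_limit_exists d β A) :
    IsSourcedCurrentLimit d β A (sourcedCurrentLaw d β A) := by
  rw [sourcedCurrentLaw, dif_pos h]
  exact h.choose_spec

/-- The junk case: no limit, zero measure. [folklore] -/
theorem sourcedCurrentLaw_of_not_exists {β : ℝ} {A : Finset (Site d)}
    (h : ¬ sourcedCurrentLaw_limit_exists d β A) : sourcedCurrentLaw d β A = 0 := by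
  rw [sourcedCurrentLaw, dif_neg h]

/-- **Uniqueness**: any local weak limit of the torus sourced currents *is* `sourcedCurrentLaw d β A`. [cite: AizenmanEtAl2019, §2.3] -/
theorem IsSourcedCurrentLimit.eq_sourcedCurrentLaw {β : ℝ} {A : Finset (Site d)}
    {μ : Measure (Sym2 (Site d) → ℕ)} (hμ : IsSourcedCurrentLimit d β A μ) :
    μ = sourcedCurrentLaw d β A :=
  IsLocalLimit.unique hμ (isSourcedCurrentLimit_sourcedCurrentLaw ⟨μ, hμ⟩)

/-- When the limit exists, `sourcedCurrentLaw d β A` is a probability measure. [cite: AizenmanEtAl2019, §2.3] -/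
theorem isProbabilityMeasure_sourcedCurrentLaw {β : ℝ} {A : Finset (Site d)}
    (h : sourcedCurrentLaw_limit_exists d β A) : IsProbabilityMeasure (sourcedCurrentLaw d β A) :=
  (isSourcedCurrentLimit_sourcedCurrentLaw h).isProbabilityMeasure

/-- **R1 for the sourced current**: when the limit exists, the torus probabilities of every event
depending on finitely many bonds converge to its `sourcedCurrentLaw d β A`-probability. [cite: AizenmanDuminilCopinSidoraviciusCMP2015, Thm. 2.3 (R1)] -/
theorem tendsto_torusCurrentLaw_real {β : ℝ} {A : Finset (Site d)}
    (h : sourcedCurrentLaw_limit_exists d β A) {E : Set (Sym2 (Site d) → ℕ)}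
    {F : Finset (Sym2 (Site d))} (hE : DependsOn (· ∈ E) (F : Set (Sym2 (Site d)))) :
    Tendsto (fun N : ℕ => (torusCurrentLaw d (N + 1) β A).real E) atTop
      (𝓝 ((sourcedCurrentLaw d β A).real E)) :=
  (isSourcedCurrentLimit_sourcedCurrentLaw h).tendsto_of_dependsOn E F hE

end Infinite

/-! ### Sanity check at `β = 0`: the sourceless current is the zero current -/

section BetaZero

variable {V : Type*} [Fintype V] [DecidableEq V] (G : SimpleGraph V) [DecidableRel G.Adj]

omit [DecidableEq V] in
/-- At `β = 0` only the zero current has nonzero weight: `w_0(n) = 𝟙[n = 0]`. [folklore] -/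
theorem Current.weight_zero_beta (n : Current G) : n.weight 0 = if n = 0 then 1 else 0 := by
  split_ifs with h
  · subst h; exact Current.weight_zero 0
  · obtain ⟨e, he⟩ : ∃ e, n e ≠ 0 := by
      by_contra hne
      push Not at hne
      exact h (funext hne)
    exact Finset.prod_eq_zero (Finset.mem_univ e) (by simp [zero_pow he])

/-- At `β = 0` the sourceless single-current probabilities are `𝟙[n = 0]`. [folklore] -/
theorem currentProb_zero_empty (n : Current G) : currentProb G 0 ∅ n = if n = 0 then 1 else 0 := by
  have hterm : ∀ m : Current G, (if m.sources = ∅ then m.weight 0 else 0) = if m = 0 then 1 else 0 := by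
    intro m
    rw [Current.weight_zero_beta]
    by_cases hm : m = 0
    · subst hm; simp
    · simp [hm]
  have hZ : currentSum G 0 ∅ = 1 := by
    rw [currentSum]
    simp_rw [hterm]
    rw [tsum_eq_single 0 (fun m hm => if_neg hm)]
    simp
  rw [currentProb, hZ, div_one, hterm]

/-- At `β = 0` the sourceless random current is the Dirac mass at the zero current. [folklore] -/
theorem currentLaw_zero_empty : currentLaw G 0 ∅ = Measure.dirac 0 := by
  classical
  ext s hs
  rw [currentLaw_apply, Measure.dirac_apply, tsum_eq_single 0 (fun n hn => ?_)]
  · by_cases h0 : (0 : Current G) ∈ s <;> simp [h0, currentProb_zero_empty]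
  · simp [currentProb_zero_empty, hn]

/-- **Non-vacuity of the definitions**: at `β = 0` the infinite-volume sourceless current exists
and is the Dirac mass at the zero configuration (every torus law is). [folklore] -/
theorem isSourcedCurrentLimit_zero_empty (d : ℕ) :
    IsSourcedCurrentLimit d 0 ∅ (Measure.dirac 0) := by
  have hlaw : ∀ N : ℕ, torusCurrentLaw d (N + 1) 0 ∅ = Measure.dirac 0 := fun N => by
    rw [torusCurrentLaw, Finset.image_empty, currentLaw_zero_empty,
      Measure.map_dirac' (Torus.measurable_liftCurrent d (N + 1)), Torus.liftCurrent_zero]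
  refine ⟨inferInstance, fun E F _ => ?_⟩
  simp_rw [hlaw]
  exact tendsto_const_nhds

/-- Hence `sourcedCurrentLaw d 0 ∅ = δ_0`: the limit exists and the definition returns it, not the
junk value. [folklore] -/
theorem sourcedCurrentLaw_zero_empty (d : ℕ) : sourcedCurrentLaw d 0 ∅ = Measure.dirac 0 :=
  ((isSourcedCurrentLimit_zero_empty d).eq_sourcedCurrentLaw).symm

end BetaZero

end Literature.Probability.LatticeModels
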